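import Summits.Parity.GeneralizedHardyLittlewood.Theorems.LeeYangFibresRelativeDimOneMoebiusSplitDefs
import Literature.NumberTheory.Sieve.LinearEquationsInPrimesDimOne
import Mathlib.Data.Int.Interval
import Mathlib.Analysis.SpecialFunctions.Pow.Asymptotics
import Mathlib.Analysis.Convex.Basic
import HarnessLib

/-!
# Route `LeeYangFibres`, crux `RelativeDimOne` (stmt-Parity-14113), line `single-moebius-split`:
# stub T1a `stub_truncLatticeCount` — lattice count / volume packing for the all-truncated sum

For levels `R_i = N^{δ_i}` with `δ_i > 0`, `∑ δ_i ≤ 1/4`, uniformly over `d = 1` systems `Ψ` and convex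
`K ⊆ [-N, N]`:
`|∑_{n ∈ K ∩ ℤ} ∏_i Λ_{R_i}(ψ_i(n)) − β_∞(Ψ, K) · 𝔖_R(Ψ)| ≤ ε N` for `N ≥ N₀(t, δ, ε)`
(`TruncLatticeCount`, registered stub `stub_truncLatticeCount : ∀ k, TruncLatticeCount (k + 1)`).

The proof is elementary (no primes, no non-degeneracy, no size bound):
* `lambdaR_eq_sum_Icc`: `Λ_R(m) = ∑_{1 ≤ e ≤ R} [m > 0, e ∣ m] μ(e) log(R/e)`;
* `truncCorrSum_eq`: expanding the product over tuples `e = (e_i)`, the all-truncated sum is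
  `∑_e w(e) · #{n ∈ K ∩ [-N, N] : ψ_i(n) > 0, e_i ∣ ψ_i(n) ∀ i}`, `w(e) = ∏ μ(e_i) log(R_i/e_i)`;
* `card_filter_Ico_block`, `card_filter_Ico_blocks`, `abs_card_filter_Icc_sub_le`: a `D`-periodic
  predicate with `c` solutions per period has `#[m₁, m₂] · c/D ± c` solutions in an integer interval;
* `abs_count_sub_le`: the positivity region `K ∩ {ψ_i > 0}` is an interval of length `β_∞`
  (`DimOne.exists_filter_eq_Icc`, `DimOne.archFactor_eq`) and `{e_i ∣ ψ_i(n) ∀ i}` is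
  `∏ e_i`-periodic with `ρ_Ψ(e) = solCount Ψ e` solutions per period, so the count is
  `β_∞ ρ_Ψ(e)/∏ e_i ± 2ρ_Ψ(e)`;
* trivial bounds `ρ_Ψ(e) ≤ ∏ e_i`, `|w(e)| ≤ (log N)^t` give a total error
  `≤ 2 (log N)^t ∏_i R_i² ≤ 2 (log N)^t N^{1/2} ≤ ε N`.

References: D. A. Goldston, C. Y. Yıldırım, Integers 3 (2003) A5 [GoldstonYildirim2001];
B. Green, T. Tao, Ann. of Math. 171 (2010), App. D [GreenTao2010].
-/

noncomputable section

open scoped BigOperators Classical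
open Filter Finset Literature.NumberTheory.Sieve

namespace Summit.Parity.GeneralizedHardyLittlewood.Cruxes.RelativeDimOne.SingleMoebiusSplit

/-! ### Periodic predicates on integer intervals -/

/-- A block of `D` consecutive integers contains exactly `#{n < D : P n}` solutions of a predicate
`P` that only depends on the residue mod `D`. -/
theorem card_filter_Ico_block (P : ℤ → Prop) [DecidablePred P] {D : ℕ} (hD : 0 < D)
    (hP : ∀ m, P (m % (D : ℤ)) ↔ P m) (a : ℤ) :
    #((Ico a (a + D)).filter P) = #((range D).filter (fun n : ℕ => P n)) := by
  have hD0 : (0 : ℤ) ≤ (D : ℤ) := by exact_mod_cast hD.le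
  have himg := Int.image_Ico_emod a (D : ℤ) hD0
  have hinj : Set.InjOn (fun m : ℤ => m % (D : ℤ)) (Ico a (a + D) : Finset ℤ) := by
    rw [← Finset.card_image_iff, himg, Int.card_Ico, Int.card_Ico]
    omega
  calc #((Ico a (a + D)).filter P)
      = #(((Ico a (a + D)).filter P).image (fun m : ℤ => m % (D : ℤ))) :=
        (Finset.card_image_of_injOn
          (hinj.mono (Finset.coe_subset.mpr (Finset.filter_subset _ _)))).symm
    _ = #(((Ico a (a + D)).image (fun m : ℤ => m % (D : ℤ))).filter P) := by
        rw [Finset.filter_image, Finset.filter_congr (fun m _ => hP m)]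
    _ = #((Ico (0 : ℤ) D).filter P) := by rw [himg]
    _ = #((range D).filter (fun n : ℕ => P n)) := by
        refine Finset.card_nbij' (fun m : ℤ => m.toNat) (fun n : ℕ => (n : ℤ)) ?_ ?_ ?_ ?_
        · intro m hm
          simp only [Finset.coe_filter, Finset.mem_Ico, Finset.mem_range, Set.mem_setOf_eq] at hm ⊢
          refine ⟨by omega, ?_⟩
          rw [Int.toNat_of_nonneg hm.1.1]
          exact hm.2
        · intro n hn
          simp only [Finset.coe_filter, Finset.mem_range, Finset.mem_Ico, Set.mem_setOf_eq] at hn ⊢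
          exact ⟨⟨by omega, by omega⟩, hn.2⟩
        · intro m hm
          simp only [Finset.coe_filter, Finset.mem_Ico, Set.mem_setOf_eq] at hm
          exact Int.toNat_of_nonneg hm.1.1
        · intro n _
          exact Int.toNat_natCast n

/-- `q` consecutive blocks of `D` integers contain exactly `q · #{n < D : P n}` solutions. -/
theorem card_filter_Ico_blocks (P : ℤ → Prop) [DecidablePred P] {D : ℕ} (hD : 0 < D)
    (hP : ∀ m, P (m % (D : ℤ)) ↔ P m) (a : ℤ) (q : ℕ) :
    #((Ico a (a + q * D)).filter P) = q * #((range D).filter (fun n : ℕ => P n)) := by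
  induction q with
  | zero => simp
  | succ q ih =>
    have hq0 : (0 : ℤ) ≤ (q : ℤ) * D := by positivity
    have hsplit : Ico a (a + ((q + 1 : ℕ) : ℤ) * D) =
        Ico a (a + q * D) ∪ Ico (a + q * D) (a + q * D + D) := by
      rw [Finset.Ico_union_Ico_eq_Ico (by linarith) (by linarith)]
      congr 1; push_cast; ring
    rw [hsplit, Finset.filter_union,
      Finset.card_union_of_disjoint
        (Finset.disjoint_filter_filter (Finset.Ico_disjoint_Ico_consecutive _ _ _)),
      ih, card_filter_Ico_block P hD hP, Nat.succ_mul]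

/-- On an integer interval, a `D`-periodic predicate with `c` solutions per period has
`#[m₁, m₂] · c / D ± c` solutions. -/
theorem abs_card_filter_Icc_sub_le (P : ℤ → Prop) [DecidablePred P] {D : ℕ} (hD : 0 < D)
    (hP : ∀ m, P (m % (D : ℤ)) ↔ P m) (m₁ m₂ : ℤ) :
    |(#((Icc m₁ m₂).filter P) : ℝ) -
        #(Icc m₁ m₂) * #((range D).filter (fun n : ℕ => P n)) / D| ≤
      #((range D).filter (fun n : ℕ => P n)) := by
  set c := #((range D).filter (fun n : ℕ => P n))
  set n := #(Icc m₁ m₂) with hn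
  have hIcc : Icc m₁ m₂ = Ico m₁ (m₁ + n) := by
    ext m
    simp only [Finset.mem_Icc, Finset.mem_Ico, hn, Int.card_Icc]
    omega
  set q := n / D with hq
  have h1 : q * D ≤ n := Nat.div_mul_le_self n D
  have h2 : n < (q + 1) * D := by
    have := Nat.lt_mul_div_succ n hD
    rw [← hq] at this
    linarith
  have hlow : q * c ≤ #((Icc m₁ m₂).filter P) := by
    rw [← card_filter_Ico_blocks P hD hP m₁ q]
    refine Finset.card_le_card (Finset.filter_subset_filter P ?_)
    rw [hIcc]
    refine Finset.Ico_subset_Ico_right ?_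
    have : ((q * D : ℕ) : ℤ) ≤ n := by exact_mod_cast h1
    push_cast at this
    linarith
  have hup : #((Icc m₁ m₂).filter P) ≤ (q + 1) * c := by
    rw [← card_filter_Ico_blocks P hD hP m₁ (q + 1)]
    refine Finset.card_le_card (Finset.filter_subset_filter P ?_)
    rw [hIcc]
    refine Finset.Ico_subset_Ico_right ?_
    have : (n : ℤ) ≤ ((q + 1) * D : ℕ) := by exact_mod_cast h2.le
    push_cast at this ⊢
    linarith
  have hD0 : (0 : ℝ) < D := by exact_mod_cast hD
  have hc0 : (0 : ℝ) ≤ c := Nat.cast_nonneg _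
  have h1R : (q : ℝ) * D ≤ n := by exact_mod_cast h1
  have h2R : (n : ℝ) ≤ (q + 1) * D := by exact_mod_cast h2.le
  have hlowR : (q : ℝ) * c ≤ (#((Icc m₁ m₂).filter P) : ℝ) := by exact_mod_cast hlow
  have hupR : (#((Icc m₁ m₂).filter P) : ℝ) ≤ (q + 1) * c := by exact_mod_cast hup
  have hX1 : (q : ℝ) * c ≤ n * c / D := by
    rw [le_div_iff₀ hD0]
    nlinarith
  have hX2 : (n : ℝ) * c / D ≤ (q + 1) * c := by
    rw [div_le_iff₀ hD0]
    nlinarith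
  rw [abs_le]
  constructor <;> linarith

/-! ### The count attached to one tuple of moduli -/

/-- **Volume packing for one tuple.** For `e_i ≥ 1`, the number of `n ∈ K ∩ [-N, N]` with
`ψ_i(n) > 0` and `e_i ∣ ψ_i(n)` for all `i` is `β_∞(Ψ, K) ρ_Ψ(e)/∏ e_i ± 2ρ_Ψ(e)`: the positivity
region is an interval of length `β_∞` (up to one lattice point) and the divisibility system is
`∏ e_i`-periodic with `ρ_Ψ(e)` solutions per period. -/
theorem abs_count_sub_le {t : ℕ} (Ψ : Fin t → AffLinForm 1) {N : ℕ} {K : Set (Fin 1 → ℝ)}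
    (hK : Convex ℝ K) (hKN : K ⊆ realBox 1 N) (d : Fin t → ℕ) (hd : ∀ i, 0 < d i) :
    |(#((latticeBox 1 N).filter (fun n => realPoint n ∈ K ∧
          ∀ i, 0 < (Ψ i).eval n ∧ ((d i : ℕ) : ℤ) ∣ (Ψ i).eval n)) : ℝ) -
        archFactor Ψ K * solCount Ψ d / ∏ i, (d i : ℝ)| ≤ 2 * solCount Ψ d := by
  -- the divisibility predicate and its period
  obtain ⟨D, hDdef⟩ : ∃ D : ℕ, D = ∏ i, d i := ⟨_, rfl⟩
  have hD : 0 < D := hDdef ▸ Finset.prod_pos fun i _ => hd i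
  obtain ⟨P, hPdef⟩ : ∃ P : ℤ → Prop, P = fun m => ∀ i, ((d i : ℕ) : ℤ) ∣ (Ψ i).eval (fun _ => m) :=
    ⟨_, rfl⟩
  have hP : ∀ m, P (m % (D : ℤ)) ↔ P m := by
    intro m
    rw [hPdef]
    refine forall_congr' fun i => ?_
    rw [DimOne.eval_eq, DimOne.eval_eq]
    refine dvd_iff_dvd_of_dvd_sub ?_
    have hdi : ((d i : ℕ) : ℤ) ∣ (D : ℤ) :=
      Int.natCast_dvd_natCast.mpr (hDdef ▸ Finset.dvd_prod_of_mem d (Finset.mem_univ i))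
    rw [show (Ψ i).coeff 0 * (m % (D : ℤ)) + (Ψ i).const - ((Ψ i).coeff 0 * m + (Ψ i).const) =
      (Ψ i).coeff 0 * (m % (D : ℤ) - m) by ring, Int.emod_def,
      show m - (D : ℤ) * (m / D) - m = (D : ℤ) * (-(m / D)) by ring]
    exact Dvd.dvd.mul_left (Dvd.dvd.mul_right hdi _) _
  have hsol : solCount Ψ d = #((range D).filter (fun n : ℕ => P n)) := by
    subst hPdef hDdef
    unfold solCount
    congr 1
    ext n
    simp only [Finset.mem_filter]
  -- the positivity slice
  obtain ⟨S, hSdef⟩ : ∃ S : Set ℝ,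
      S = {r | (fun _ : Fin 1 => r) ∈ K ∧ ∀ i, 0 < (Ψ i).realEval (fun _ => r)} := ⟨_, rfl⟩
  have hSo : S.OrdConnected := by
    refine Convex.ordConnected ?_
    have : S = {r | (fun _ : Fin 1 => r) ∈ K} ∩
        ⋂ i, {r : ℝ | 0 < ((Ψ i).coeff 0 : ℝ) * r + (Ψ i).const} := by
      ext r
      simp only [hSdef, Set.mem_setOf_eq, Set.mem_inter_iff, Set.mem_iInter, DimOne.realEval_eq]
    rw [this]
    exact (DimOne.convex_slice hK).inter (convex_iInter fun i => DimOne.convex_setOf_pos _ _)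
  have hSN : S ⊆ Set.Icc (-(N : ℝ)) N := by
    intro r hr
    rw [hSdef] at hr
    have h := hKN hr.1
    simp only [realBox, Set.mem_Icc] at h
    exact ⟨h.1 0, h.2 0⟩
  obtain ⟨m₁, m₂, hI, hvol⟩ := DimOne.exists_filter_eq_Icc hSo hSN
  rw [hSdef, ← DimOne.archFactor_eq Ψ K] at hvol
  -- the count is a periodic count on `[m₁, m₂]`
  have hcount : #((latticeBox 1 N).filter (fun n => realPoint n ∈ K ∧
      ∀ i, 0 < (Ψ i).eval n ∧ ((d i : ℕ) : ℤ) ∣ (Ψ i).eval n)) = #((Icc m₁ m₂).filter P) := by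
    rw [DimOne.card_filter_latticeBox, ← hI, Finset.filter_filter]
    refine congrArg Finset.card (Finset.filter_congr fun m _ => ?_)
    have hev : ∀ i, (Ψ i).realEval (fun _ => ((m : ℤ) : ℝ)) = (((Ψ i).eval (fun _ => m) : ℤ) : ℝ) :=
      fun i => by rw [DimOne.realEval_eq, DimOne.eval_eq]; push_cast; ring
    simp only [hSdef, hPdef, Set.mem_setOf_eq, hev, Int.cast_pos, DimOne.realPoint_const, forall_and,
      and_assoc]
  -- assemble
  have h1 := abs_card_filter_Icc_sub_le P hD hP m₁ m₂
  rw [hcount, hsol, ← Nat.cast_prod, ← hDdef]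
  set c := #((range D).filter (fun n : ℕ => P n))
  set F : ℝ := (#((Icc m₁ m₂).filter P) : ℝ)
  set n : ℝ := (#(Icc m₁ m₂) : ℝ)
  have hD0 : (0 : ℝ) < D := by exact_mod_cast hD
  have hD1 : (1 : ℝ) ≤ D := by exact_mod_cast hD
  have hc0 : (0 : ℝ) ≤ c := Nat.cast_nonneg _
  have hcD : (c : ℝ) / D ≤ c := div_le_self hc0 hD1
  calc |F - archFactor Ψ K * c / D|
      = |(F - n * c / D) + (n - archFactor Ψ K) * (c / D)| := by congr 1; ring
    _ ≤ |F - n * c / D| + |(n - archFactor Ψ K) * (c / D)| := abs_add_le _ _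
    _ ≤ c + 1 * (c / D) := by
        rw [abs_mul, abs_of_nonneg (div_nonneg hc0 hD0.le)]
        exact add_le_add h1 (mul_le_mul_of_nonneg_right hvol (div_nonneg hc0 hD0.le))
    _ ≤ 2 * c := by linarith

/-! ### Expansion of the truncated divisor sums -/

/-- The divisors of `m⁺` up to `R ≥ 0` are the `e ∈ [1, R]` with `m > 0` and `e ∣ m`. -/
theorem divisors_filter_eq {R : ℝ} (hR : 0 ≤ R) (m : ℤ) :
    (Nat.divisors m.toNat).filter (fun e : ℕ => (e : ℝ) ≤ R) =
      (Icc 1 ⌊R⌋₊).filter (fun e : ℕ => 0 < m ∧ (e : ℤ) ∣ m) := by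
  ext e
  simp only [Finset.mem_filter, Nat.mem_divisors, Finset.mem_Icc]
  constructor
  · rintro ⟨⟨hdvd, hm0⟩, heR⟩
    have hm : 0 < m := not_le.mp fun h => hm0 (Int.toNat_eq_zero.mpr h)
    have he0 : 0 < e := Nat.pos_of_dvd_of_pos hdvd (Nat.pos_of_ne_zero hm0)
    refine ⟨⟨he0, (Nat.le_floor_iff hR).mpr heR⟩, hm, ?_⟩
    rw [← Int.toNat_of_nonneg hm.le]
    exact Int.natCast_dvd_natCast.mpr hdvd
  · rintro ⟨⟨_, heR⟩, hm, hdvd⟩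
    refine ⟨⟨?_, ?_⟩, (Nat.le_floor_iff hR).mp heR⟩
    · rw [← Int.toNat_of_nonneg hm.le] at hdvd
      exact Int.natCast_dvd_natCast.mp hdvd
    · exact fun h => absurd hm (not_lt.mpr (Int.toNat_eq_zero.mp h))

/-- `Λ_R(m) = ∑_{1 ≤ e ≤ R} [m > 0 ∧ e ∣ m] μ(e) log(R/e)` (`R ≥ 0`). -/
theorem lambdaR_eq_sum_Icc {R : ℝ} (hR : 0 ≤ R) (m : ℤ) :
    lambdaR R m = ∑ e ∈ Icc 1 ⌊R⌋₊,
      if 0 < m ∧ (e : ℤ) ∣ m then ((ArithmeticFunction.moebius e : ℤ) : ℝ) * Real.log (R / e)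
        else 0 := by
  rw [← Finset.sum_filter (fun e : ℕ => 0 < m ∧ (e : ℤ) ∣ m), ← divisors_filter_eq hR m]
  rfl

/-- Expansion of `∏_i Λ_{R_i}(x_i)` over tuples of divisors. -/
theorem prod_lambdaR_eq {t : ℕ} (R : Fin t → ℝ) (hR : ∀ i, 0 ≤ R i) (x : Fin t → ℤ) :
    ∏ i, lambdaR (R i) (x i) = ∑ e ∈ Fintype.piFinset (fun i => Icc 1 ⌊R i⌋₊),
      if ∀ i, 0 < x i ∧ ((e i : ℕ) : ℤ) ∣ x i then
        ∏ i, ((ArithmeticFunction.moebius (e i) : ℤ) : ℝ) * Real.log (R i / (e i : ℝ)) else 0 := by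
  have h : ∀ i, lambdaR (R i) (x i) = ∑ e ∈ Icc 1 ⌊R i⌋₊,
      if 0 < x i ∧ (e : ℤ) ∣ x i then ((ArithmeticFunction.moebius e : ℤ) : ℝ) * Real.log (R i / e)
        else 0 := fun i => lambdaR_eq_sum_Icc (hR i) (x i)
  simp only [h]
  rw [Finset.prod_univ_sum]
  refine Finset.sum_congr rfl fun e _ => ?_
  rw [Fintype.prod_ite_zero]
  congr 1

/-- **Expansion of the all-truncated sum over tuples of divisors**:
`∑_{n ∈ K ∩ ℤ} ∏_i Λ_{R_i}(ψ_i(n)) = ∑_e (∏_i μ(e_i) log(R_i/e_i)) · #{n : ψ_i(n) > 0, e_i ∣ ψ_i(n) ∀ i}`. -/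
theorem truncCorrSum_eq {t : ℕ} (Ψ : Fin t → AffLinForm 1) (K : Set (Fin 1 → ℝ)) (N : ℕ)
    (R : Fin t → ℝ) (hR : ∀ i, 0 ≤ R i) :
    truncCorrSum Ψ K N R = ∑ e ∈ Fintype.piFinset (fun i => Icc 1 ⌊R i⌋₊),
      (∏ i, ((ArithmeticFunction.moebius (e i) : ℤ) : ℝ) * Real.log (R i / (e i : ℝ))) *
        #((latticeBox 1 N).filter (fun n => realPoint n ∈ K ∧
            ∀ i, 0 < (Ψ i).eval n ∧ ((e i : ℕ) : ℤ) ∣ (Ψ i).eval n)) := by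
  unfold truncCorrSum
  simp only [prod_lambdaR_eq R hR]
  rw [Finset.sum_comm]
  refine Finset.sum_congr rfl fun e _ => ?_
  rw [← Finset.sum_filter, Finset.sum_const, nsmul_eq_mul, mul_comm, Finset.filter_filter]

/-! ### The stub -/

/-- `|w · c − A · (w · s / D)| ≤ W · E` from `|w| ≤ W` and `|c − A s / D| ≤ E`. -/
theorem abs_term_le {w c A s D W E : ℝ} (hw : |w| ≤ W) (hc : |c - A * s / D| ≤ E) :
    |w * c - A * (w * s / D)| ≤ W * E := by
  rw [show w * c - A * (w * s / D) = w * (c - A * s / D) by ring, abs_mul]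
  exact mul_le_mul hw hc (abs_nonneg _) ((abs_nonneg w).trans hw)

/-- **T1a (registered stub `stub_truncLatticeCount`).** CRT / volume packing: the all-truncated sum
is `β_∞ · 𝔖_R(Ψ)` up to `εN` — see `TruncLatticeCount`. Expanding over tuples `e` (`truncCorrSum_eq`),
each count is `β_∞ ρ_Ψ(e)/∏ e_i ± 2ρ_Ψ(e)` (`abs_count_sub_le`); with `ρ_Ψ(e) ≤ ∏ e_i` and
`|w(e)| ≤ (log N)^{k+1}` the total error is `≤ 2 (log N)^{k+1} ∏_i R_i² ≤ 2 (log N)^{k+1} N^{1/2} ≤ εN`. -/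
theorem stub_truncLatticeCount : ∀ k : ℕ, TruncLatticeCount (k + 1) := by
  intro k _L δ hδ hsum ε hε
  -- threshold: `(log N)^(k+1) ≤ (ε/2) N^{1/2}` for `N ≥ X`
  obtain ⟨X, hX⟩ := Filter.eventually_atTop.mp
    ((isLittleO_log_rpow_rpow_atTop ((k + 1 : ℕ) : ℝ) (by norm_num : (0 : ℝ) < 1 / 2)).bound
      (half_pos hε))
  refine ⟨max 1 ⌈X⌉₊, fun N hN Ψ _ _ K hK hKN => ?_⟩
  have hN1 : 1 ≤ N := le_of_max_le_left hN
  have hN1R : (1 : ℝ) ≤ (N : ℝ) := by exact_mod_cast hN1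
  have hN0R : (0 : ℝ) < (N : ℝ) := by linarith
  have hNX : X ≤ (N : ℝ) := (Nat.le_ceil X).trans (by exact_mod_cast le_of_max_le_right hN)
  have hlogN : 0 ≤ Real.log N := Real.log_nonneg hN1R
  set R : Fin (k + 1) → ℝ := fun i => (N : ℝ) ^ (δ i) with hRdef
  have hR0 : ∀ i, 0 ≤ R i := fun i => Real.rpow_nonneg hN0R.le _
  have hδle : ∀ i, δ i ≤ 1 := fun i =>
    ((Finset.single_le_sum (fun j _ => (hδ j).le) (Finset.mem_univ i)).trans hsum).trans
      (by norm_num)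
  have hRN : ∀ i, R i ≤ N := fun i => by
    have := Real.rpow_le_rpow_of_exponent_le hN1R (hδle i)
    rwa [Real.rpow_one] at this
  -- the weights are at most `(log N)^(k+1)`
  have hw : ∀ e ∈ Fintype.piFinset (fun i => Icc 1 ⌊R i⌋₊),
      |∏ i, ((ArithmeticFunction.moebius (e i) : ℤ) : ℝ) * Real.log (R i / (e i : ℝ))| ≤
        Real.log N ^ (k + 1) := by
    intro e he
    rw [Finset.abs_prod]
    have he' := Fintype.mem_piFinset.mp he
    calc ∏ i, |((ArithmeticFunction.moebius (e i) : ℤ) : ℝ) * Real.log (R i / (e i : ℝ))|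
        ≤ ∏ _i : Fin (k + 1), Real.log N := by
          refine Finset.prod_le_prod (fun i _ => abs_nonneg _) fun i _ => ?_
          obtain ⟨h1, h2⟩ := Finset.mem_Icc.mp (he' i)
          have he0 : (0 : ℝ) < e i := by exact_mod_cast h1
          have heR : (e i : ℝ) ≤ R i := (Nat.le_floor_iff (hR0 i)).mp h2
          have h1le : 1 ≤ R i / e i := by rw [le_div_iff₀ he0, one_mul]; exact heR
          have hlog0 : 0 ≤ Real.log (R i / e i) := Real.log_nonneg h1le
          have hlogle : Real.log (R i / e i) ≤ Real.log N := by
            refine Real.log_le_log (by positivity) ?_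
            calc R i / e i ≤ R i := div_le_self (hR0 i) (by exact_mod_cast h1)
              _ ≤ N := hRN i
          rw [abs_mul, abs_of_nonneg hlog0]
          calc |((ArithmeticFunction.moebius (e i) : ℤ) : ℝ)| * Real.log (R i / e i)
              ≤ 1 * Real.log N := by
                refine mul_le_mul ?_ hlogle hlog0 zero_le_one
                rw [← Int.cast_abs]
                exact_mod_cast ArithmeticFunction.abs_moebius_le_one
            _ = Real.log N := one_mul _
      _ = Real.log N ^ (k + 1) := by
          rw [Finset.prod_const, Finset.card_univ, Fintype.card_fin]
  -- expand both sides over tuples of divisors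
  rw [truncCorrSum_eq Ψ K N R hR0, truncSingularSeries, Finset.mul_sum, ← Finset.sum_sub_distrib]
  refine (Finset.abs_sum_le_sum_abs _ _).trans ?_
  refine (Finset.sum_le_sum (g := fun e => Real.log N ^ (k + 1) * (2 * ∏ i, (e i : ℝ)))
    fun e he => ?_).trans ?_
  · -- one tuple: weight times lattice count
    have he' := Fintype.mem_piFinset.mp he
    have hepos : ∀ i, 0 < e i := fun i => (Finset.mem_Icc.mp (he' i)).1
    refine abs_term_le (hw e he) ((abs_count_sub_le Ψ hK hKN e hepos).trans ?_)
    have : (solCount Ψ e : ℝ) ≤ ∏ i, (e i : ℝ) := by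
      rw [← Nat.cast_prod]
      exact_mod_cast (Finset.card_filter_le _ _).trans (Finset.card_range _).le
    linarith
  -- sum of the bounds: `2 (log N)^(k+1) ∏_i (∑_{j ≤ R_i} j) ≤ 2 (log N)^(k+1) N^{1/2} ≤ ε N`
  have hc0 : 0 ≤ 2 * Real.log N ^ (k + 1) := mul_nonneg (by norm_num) (pow_nonneg hlogN _)
  calc ∑ e ∈ Fintype.piFinset (fun i => Icc 1 ⌊R i⌋₊),
        Real.log N ^ (k + 1) * (2 * ∏ i, (e i : ℝ))
      = 2 * Real.log N ^ (k + 1) * ∏ i, ∑ j ∈ Icc 1 ⌊R i⌋₊, (j : ℝ) := by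
        rw [Finset.prod_univ_sum, Finset.mul_sum]
        refine Finset.sum_congr rfl fun e _ => ?_
        ring
    _ ≤ 2 * Real.log N ^ (k + 1) * ∏ i, R i ^ 2 := by
        refine mul_le_mul_of_nonneg_left ?_ hc0
        refine Finset.prod_le_prod (fun i _ => Finset.sum_nonneg fun j _ => Nat.cast_nonneg j)
          fun i _ => ?_
        calc ∑ j ∈ Icc 1 ⌊R i⌋₊, (j : ℝ) ≤ ∑ _j ∈ Icc 1 ⌊R i⌋₊, (⌊R i⌋₊ : ℝ) :=
              Finset.sum_le_sum fun j hj => by exact_mod_cast (Finset.mem_Icc.mp hj).2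
          _ = ⌊R i⌋₊ * ⌊R i⌋₊ := by
              rw [Finset.sum_const, nsmul_eq_mul, Nat.card_Icc, Nat.add_sub_cancel]
          _ ≤ R i ^ 2 := by
              have := Nat.floor_le (hR0 i)
              rw [sq]
              exact mul_le_mul this this (Nat.cast_nonneg _) (hR0 i)
    _ = 2 * Real.log N ^ (k + 1) * (N : ℝ) ^ (2 * ∑ i, δ i) := by
        congr 1
        rw [Finset.mul_sum, Real.rpow_sum_of_pos hN0R]
        refine Finset.prod_congr rfl fun i _ => ?_
        rw [hRdef]
        dsimp only
        rw [← Real.rpow_natCast, ← Real.rpow_mul hN0R.le]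
        congr 1
        push_cast
        ring
    _ ≤ 2 * Real.log N ^ (k + 1) * (N : ℝ) ^ (1 / 2 : ℝ) := by
        refine mul_le_mul_of_nonneg_left (Real.rpow_le_rpow_of_exponent_le hN1R ?_) hc0
        linarith
    _ ≤ 2 * (ε / 2 * (N : ℝ) ^ (1 / 2 : ℝ)) * (N : ℝ) ^ (1 / 2 : ℝ) := by
        have hX' := hX N hNX
        rw [Real.norm_of_nonneg (Real.rpow_nonneg hlogN _),
          Real.norm_of_nonneg (Real.rpow_nonneg hN0R.le _), Real.rpow_natCast] at hX'
        refine mul_le_mul_of_nonneg_right (mul_le_mul_of_nonneg_left hX' (by norm_num)) ?_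
        exact Real.rpow_nonneg hN0R.le _
    _ = ε * N := by
        rw [show 2 * (ε / 2 * (N : ℝ) ^ (1 / 2 : ℝ)) * (N : ℝ) ^ (1 / 2 : ℝ) =
          ε * ((N : ℝ) ^ (1 / 2 : ℝ) * (N : ℝ) ^ (1 / 2 : ℝ)) by ring, ← Real.rpow_add hN0R]
        norm_num

end Summit.Parity.GeneralizedHardyLittlewood.Cruxes.RelativeDimOne.SingleMoebiusSplit
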